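import Literature.Analysis.OperatorTheory.Enflo2023.StepRealisationDiagLow
import HarnessLib

/-!
# Enflo (2023), Part B, the (34) side at the TEXT'S OWN MODULUS: along the scheduled run of the type-1 model
`T_τ = diag(τ, τ/2)` the two-fold independence (34) — the record's `IndepAtκ` — HOLDS AT EVERY STATE with ONE FIXED
modulus `σ ≤ ‖T‖/12` (∋ `σ = δ₂ = (‖T‖/2)²`), uniformly in `(εθ)_n → 0` (`StepRealisation.Diag`, low-modulus regime)

P. H. Enflo, *On the invariant subspace problem in Hilbert spaces*, arXiv:2305.15442v2 (2023) — a CLAIMED result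
under adjudication; nothing in this file asserts the manuscript's theorem.

WHAT THIS FILE DECIDES.

1. (34) ALONG THE ORBIT, DECIDED for `d = 2`.  `Diag.exists_scheduled_run_indep`: for `0 < τ ≤ 1/100`, modulus
   `0 < σ ≤ τ/12` and ratio `0 < β ≤ σ²/1000`, the scheduled run `s_n` of `StepRealisationDiagLow` (admissible cyclic
   true-MC start `s₀` at `x₀ = (4/5, 3/5)`; `ReachD (ιS S) σ β s₀ s_n`; `(εθ)_n = (1−β)ⁿ(εθ)₀`; `x₀ − v_n → (4/5)u₀`,
   a non-cyclic vector) satisfies AT EVERY `n` the record's state-level form of (34), `IndepAtκ (ιS S) σ s_n (x₀ − v_n)`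
   (`fK_indepAtκ`): every target pair `t` — side effect `⟨κ(x₀ − v_n), (N + N†)ℓ_n⟩` in units of `‖ℓ_n‖‖κ(x₀ − v_n)‖`,
   decrease `Re⟨π₀, (N + N†)ℓ_n⟩` in units of `(εθ)_n` — is the first-order effect of a direction `N ∈ {S}'` with
   `‖N‖ ≤ ‖t‖/σ`.  Moreover the record's run-level predicate `IndepRunD`, RESTRICTED TO THE PIVOT/STATE PAIRS OF THE
   RUN, holds (`fK_indepRun`): on the run the epoch invariant `InvP (22/σ) s_m (x₀ − v_m) s_n` forces `n = m`
   (`fK_invP_eq`: the accumulated side condition is `(3/5 − ζ_m)(ζ_n − ζ_m)`).  `exists_scheduled_run_indep_at_type1Const`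
   is the instance `σ = (τ/2)² = δ₂`, the model's own type-1 constant at `j₂ = 2` (`Diag.type1`; `δ₂ ≤ τ/12`).

2. THE MECHANISM (why the cost does not blow up as `(εθ) → 0`).  At the family state `(V_{y(κ)}, z(κ))` of
   `StepRealisationDiagLow` (`s = κ²G₁₁ ≤ 1/1000`) all four step vectors are explicit in the kernel pair
   `g_τ, g_{τ/2}` (eigenvectors of `S†`): `ℓ = ζκ·g_{τ/2}` (`ba_K`), `[ ]⁻¹(x₀ − z) = q` (`isBracket_q`, via
   `D = det(1 + WW†)`, `DK_sub_eq`), `κ(x₀ − z) = k₀g_τ + k₁g_{τ/2}` with `0 ≤ k₁ ≤ k₀/1000` and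
   `ζκ ∈ [0.997k₀, 1.002k₀]` (`bκ_K`, `k1_le`, `E_bounds`), `π₀ = 2κ(x₀ − z) − ℓ` (`bπ_K`).  So the minimiser lies on the
   RESIDUAL kernel vector and the side-condition vector (to three digits) on the OTHER one.  For the three-parameter
   directions `N = X + (Y + iZ)S` (`Ndir3`; `⟨g_μ, (N + N†)g_ν⟩ = (2X + Y(μ+ν) + iZ(μ−ν))⟨g_μ, g_ν⟩`,
   `inner_gv_Lin_gv`) the pair `Λfκ` is therefore a TRIANGULAR linear system in `(2X + 1.5τY, 2X + τY, (τ/2)Z)`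
   (`side_inner`, `dec_inner`, `Λfκ_K`), solved explicitly in `indepBrκ_K` at cost
   `|X| + |Y| + |Z| ≤ 6‖t‖ + 8.4‖t‖/τ + 2.1‖t‖/τ ≤ 12‖t‖/τ`: the two functionals are separated by the SPECTRAL GAP
   `τ/2` between the two kernel vectors, at a price `∝ 1/gap` that is UNIFORM in `κ → 0`, i.e. in `(εθ) = ζ²s → 0`.

3. CONTRAST with the calibrated obstruction.  For a LARGE modulus (`τ ≤ σ/100`: `Diag.not_indepRunκ`,
   `DiagN.not_indepRunD_two`) the same model refutes the run-level independence, and `DiagN.no_scheduled_run`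
   forbids scheduled runs; `StepRealisationDiagLow` showed that at the text's modulus
   (`σ = δ₂ ≤ ‖T‖²`, its §1) a scheduled run EXISTS (`σ ≤ τ/4`).  This file adds the (34) half on that run: in the
   text's regime the type-1 model carries, on one orbit, BOTH clauses of v2 p.19 L656–L677 — "(εθ) → 0 along
   admissible steps" and "`δ₂`-linearly independent … to arbitrarily small `(εθ)`'s".

READING for the repair record (calibration, not a claim about the text's theorem).  (i) This is the record's first
POSITIVE instance of the (34)-predicate `IndepAtκ` (typed in `StepRealisationScale`) at states of arbitrarily small
`(εθ)` with a modulus that does not shrink: the hypothesis side of the located gap is satisfiable in the intended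
regime and compatible with the scheduled decrease — the gap is not an artefact of an unsatisfiable predicate.
(ii) It does NOT decide the kernel residual `IndepRunD s₀` even in the model: `IndepRunD` quantifies (34) over every
state of the orbit TREE `ReachD (ιS S) σ β s₀` and every pivot in it, whereas `fK_indepRun` covers the pivot/state pairs
of one orbit; whether another admissible branch of the same tree reaches a state at which (34) fails at modulus `σ`
is left open (in `d = 2` the three real targets meet exactly three real first-order parameters of `{S}'` at the kernel
pair, so degenerate tree states are not excluded by anything proved here).  (iii) STATUS of the located gap is
unchanged: the unproved inference of Part B remains v2 p.19 L656–L661 (type 1, `δ₂`, `n₀` independent of `(εθ)`) ⟹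
L666–L677, typed `StepRealisation.IndepRunD`; a run in `ℂ²`, where every operator has invariant subspaces and the orbit
is given by an explicit formula, is evidence neither for nor against that inference in infinite-dimensional `H`.
Nothing is claimed for `σ > τ/12`, for `d ≥ 3`, or for infinite-dimensional `H`.

No new axioms (closure of `exists_scheduled_run_indep_at_type1Const`: `propext`, `Classical.choice`, `Quot.sound`);
zero `sorry`; the family API (`sK`, `ζK`, `MK`, `zK`, `WK`, `isBracket_K`, `cf_WK_zero/one`, `family_pos`, `stK`,
`Wn_stK`, `κseq`, `fK`, `fK_reachD`, `fK_etheta`, `fK_tendsto`, `start_arith`, …) is imported from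
`StepRealisationDiagLow` by name, the model API (`gv`, `wt`, `u`, `G`, `K_apply`, `adjoint_eq`, `inner_gv_wt`,
`inner_gv_S`, `norm_gv_sq`, `xD`, …) from `StepRealisationDiag`, the predicates `Λfκ`, `IndepBrκ`, `IndepAtκ`, `Lin`,
`bz/ba/bκ/bπ`, `Comm`, `ιS`, `InvP`, `ReachD` from `StepRealisationScale` / `StepRealisation` / `MCStep` /
`StepRealisationOrbit`.
-/

noncomputable section

open scoped InnerProductSpace ComplexConjugate
open ContinuousLinearMap Filter Topology Complex

namespace Literature.Analysis.OperatorTheory.Enflo2023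

namespace StepRealisation

open MCStep Vy
open Lemma1.Standing (e e_apply norm_e inner_e_left)

namespace Diag

/-! ### A. Letters: the determinant `D = det(1 + WW†)`, the vector `q = [ ]⁻¹(x₀ − z)` and the two coefficients
`k₀, k₁` of `κ(x₀ − z) = W†q = k₀g_τ + k₁g_{τ/2}` along the family `κ ↦ (V_{y(κ)}, z(κ))` -/

section letters

variable {τ : ℝ}

/-- `D(κ) := det(1 + K)`, `K = WW† = [[M²G₀₀, MκG₀₁], [MκG₀₁, κ²G₁₁]]`. [folklore] -/
def DK (τ κ : ℝ) : ℝ :=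
  (1 + sK τ κ) * (1 + MK τ κ ^ 2 * G τ 0 0) - MK τ κ ^ 2 * κ ^ 2 * G τ 0 1 ^ 2

/-- `q₀ := ζMκG₀₁/D` — the `u₀`-coordinate of `q = [ ]⁻¹(x₀ − z)`. [cite: Enflo2023, v2 (13)–(15) p.6] -/
def q0K (τ κ : ℝ) : ℝ := ζK τ κ * MK τ κ * κ * G τ 0 1 / DK τ κ

/-- `q₁ := ζ(D − 1 − M²G₀₀)/D` — the `u₁`-coordinate of `q = [ ]⁻¹(x₀ − z)`. [cite: Enflo2023, v2 (13)–(15) p.6] -/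
def q1K (τ κ : ℝ) : ℝ := ζK τ κ * (DK τ κ - 1 - MK τ κ ^ 2 * G τ 0 0) / DK τ κ

/-- `q = (q₀, q₁) = [ ]⁻¹(x₀ − z)`. [cite: Enflo2023, v2 (13)–(15) p.6] -/
def qK (τ κ : ℝ) : C2 := ((q0K τ κ : ℝ) : ℂ) • u 0 + ((q1K τ κ : ℝ) : ℂ) • u 1

/-- `q_0 = q₀`. [folklore] -/
@[simp] lemma qK_zero (τ κ : ℝ) : qK τ κ 0 = ((q0K τ κ : ℝ) : ℂ) := by simp [qK, u]

/-- `q_1 = q₁`. [folklore] -/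
@[simp] lemma qK_one (τ κ : ℝ) : qK τ κ 1 = ((q1K τ κ : ℝ) : ℂ) := by simp [qK, u]

/-- `k₀ := Mq₀` — the `g_τ`-coefficient of `κ(x₀ − z) = W†q`. [cite: Enflo2023, v2 (36) p.16] -/
def k0K (τ κ : ℝ) : ℝ := MK τ κ * q0K τ κ

/-- `k₁ := κq₁` — the `g_{τ/2}`-coefficient of `κ(x₀ − z) = W†q`. [cite: Enflo2023, v2 (36) p.16] -/
def k1K (τ κ : ℝ) : ℝ := κ * q1K τ κ

/-- fine Gram bounds for `0 < τ ≤ 1/100`: `1 ≤ G₁₁ ≤ G₀₁ ≤ G₀₀ ≤ 1 + 2τ²`, `Δ ≤ τ²`. [folklore] -/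
lemma G_fine (hτ : 0 < τ) (hτ1 : τ ≤ 1 / 100) :
    1 ≤ G τ 1 1 ∧ G τ 1 1 ≤ G τ 0 1 ∧ G τ 0 1 ≤ G τ 0 0 ∧ G τ 0 0 ≤ 1 + 2 * τ ^ 2 ∧ Δ τ ≤ τ ^ 2 := by
  have h1 : (0 : ℝ) < 1 - τ * τ := by nlinarith
  have h2 : (0 : ℝ) < 1 - τ / 2 * (τ / 2) := by nlinarith
  have h3 : (0 : ℝ) < 1 - τ * (τ / 2) := by nlinarith
  refine ⟨?_, ?_, ?_, ?_, ?_⟩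
  · simp only [G, wt_one]
    rw [le_inv_comm₀ (by norm_num) h2, inv_one]; nlinarith
  · simp only [G, wt_zero, wt_one]
    exact inv_anti₀ h3 (by nlinarith)
  · simp only [G, wt_zero, wt_one]
    exact inv_anti₀ h1 (by nlinarith)
  · simp only [G, wt_zero]
    have h4 : (0 : ℝ) < 1 + 2 * τ ^ 2 := by positivity
    rw [inv_le_comm₀ h1 h4, inv_eq_one_div, div_le_iff₀ h4]
    have h5 : 0 ≤ τ ^ 2 * (1 - 2 * τ ^ 2) := mul_nonneg (sq_nonneg τ) (by nlinarith)
    nlinarith [h5]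
  · rw [Δ_eq τ (by linarith) hτ, div_le_iff₀ (by positivity)]
    have h5 : (1 : ℝ) / 2 ≤ (1 - τ * τ) * (1 - τ / 2 * (τ / 2)) * (1 - τ * (τ / 2)) ^ 2 := by
      have a1 : (0.99 : ℝ) ≤ 1 - τ * τ := by nlinarith
      have a2 : (0.99 : ℝ) ≤ 1 - τ / 2 * (τ / 2) := by nlinarith
      have a3 : (0.99 : ℝ) ≤ 1 - τ * (τ / 2) := by nlinarith
      have a4 : (0.99 : ℝ) ^ 2 ≤ (1 - τ * (τ / 2)) ^ 2 := pow_le_pow_left₀ (by norm_num) a3 2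
      nlinarith [mul_le_mul a1 a2 (by norm_num) (by linarith), mul_nonneg (mul_nonneg h1.le h2.le) (sq_nonneg (1 - τ * (τ / 2)))]
    nlinarith

variable (hτ : 0 < τ) (hτ1 : τ ≤ 1 / 100) {κ : ℝ} (hκ : 0 < κ) (hs : sK τ κ ≤ 1 / 1000)
include hτ hτ1 hκ hs

/-- the two defining identities of the family: `M·ζκG₀₁ = 4/5` and `ζ(1 + s) = 3/5`. [folklore] -/
lemma family_id : MK τ κ * (ζK τ κ * κ * G τ 0 1) = 4 / 5 ∧ ζK τ κ * (1 + sK τ κ) = 3 / 5 := by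
  obtain ⟨hs0, hζ, -, -⟩ := family_pos hτ (by linarith) hκ
  obtain ⟨-, -, -, hG⟩ := G_bounds hτ (by linarith)
  refine ⟨?_, ?_⟩
  · rw [MK]; exact div_mul_cancel₀ _ (mul_pos (mul_pos hζ hκ) hG).ne'
  · rw [ζK]; exact div_mul_cancel₀ _ (by linarith)

omit hκ hs in
/-- `κ² ≤ s` (as `G₁₁ ≥ 1`). [folklore] -/
lemma κ_sq_le : κ ^ 2 ≤ sK τ κ := by
  obtain ⟨h11, -⟩ := G_fine hτ hτ1
  rw [sK]; nlinarith [sq_nonneg κ]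

/-- `1 + s ≤ D` (so `D > 0`): `D = (1+s) + M²((1+s)G₀₀ − κ²G₀₁²)` and `κ²G₀₁² ≤ 2s·G₀₀ < G₀₀`. [folklore] -/
lemma DK_ge : 1 + sK τ κ ≤ DK τ κ := by
  obtain ⟨h11, h1101, h0100, h00, -⟩ := G_fine hτ hτ1
  have hκ2 := κ_sq_le hτ hτ1 (κ := κ)
  have hB : G τ 0 1 ^ 2 ≤ 2 * G τ 0 0 := by
    have e1 : G τ 0 1 ^ 2 ≤ G τ 0 0 ^ 2 := pow_le_pow_left₀ (by linarith) h0100 2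
    have e2 : τ ^ 2 ≤ 1 / 10000 := by nlinarith
    nlinarith
  have h : κ ^ 2 * G τ 0 1 ^ 2 ≤ (1 + sK τ κ) * G τ 0 0 := by
    calc κ ^ 2 * G τ 0 1 ^ 2 ≤ sK τ κ * (2 * G τ 0 0) := mul_le_mul hκ2 hB (sq_nonneg _) (by rw [sK]; positivity)
      _ ≤ (1 + sK τ κ) * G τ 0 0 := by nlinarith
  rw [DK]
  nlinarith [sq_nonneg (MK τ κ), mul_le_mul_of_nonneg_left h (sq_nonneg (MK τ κ))]

/-- `0 < D`. [folklore] -/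
lemma DK_pos : 0 < DK τ κ := by
  have := DK_ge hτ hτ1 hκ hs
  have h0 := sK_nonneg hτ (by linarith : τ ≤ 1 / 2) κ
  linarith

omit hτ hτ1 hκ hs in
/-- `D − 1 − M²G₀₀ = s + M²κ²Δ (≥ s ≥ 0)`. [folklore] -/
lemma DK_sub_eq : DK τ κ - 1 - MK τ κ ^ 2 * G τ 0 0 = sK τ κ + MK τ κ ^ 2 * κ ^ 2 * Δ τ := by
  rw [DK, sK, Δ]; ring

/-- THE BRACKET EQUATION FOR THE PIVOT, coordinate `u₀`: `q₀(1 + M²G₀₀) + q₁MκG₀₁ = ζMκG₀₁ = 4/5 = (x₀ − z)₀`. [cite: Enflo2023, v2 (15) p.6] -/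
lemma q_row0 : q0K τ κ * (1 + MK τ κ ^ 2 * G τ 0 0) + q1K τ κ * (MK τ κ * κ * G τ 0 1) = 4 / 5 := by
  have hD := (DK_pos hτ hτ1 hκ hs).ne'
  obtain ⟨r0, -⟩ := family_id hτ hτ1 hκ hs
  have e : q0K τ κ * (1 + MK τ κ ^ 2 * G τ 0 0) + q1K τ κ * (MK τ κ * κ * G τ 0 1) =
      MK τ κ * (ζK τ κ * κ * G τ 0 1) * ((1 + MK τ κ ^ 2 * G τ 0 0) + (DK τ κ - 1 - MK τ κ ^ 2 * G τ 0 0)) / DK τ κ := by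
    rw [q0K, q1K]; field_simp
  rw [e, r0]; field_simp; ring

/-- THE BRACKET EQUATION FOR THE PIVOT, coordinate `u₁`: `q₀MκG₀₁ + q₁(1 + s) = ζs = 3/5 − ζ = (x₀ − z)₁`. [cite: Enflo2023, v2 (15) p.6] -/
lemma q_row1 : q0K τ κ * (MK τ κ * κ * G τ 0 1) + q1K τ κ * (1 + κ * κ * G τ 1 1) = 3 / 5 - ζK τ κ := by
  have hD := (DK_pos hτ hτ1 hκ hs).ne'
  obtain ⟨-, r1⟩ := family_id hτ hτ1 hκ hs
  have e : q0K τ κ * (MK τ κ * κ * G τ 0 1) + q1K τ κ * (1 + κ * κ * G τ 1 1) =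
      ζK τ κ * (MK τ κ ^ 2 * κ ^ 2 * G τ 0 1 ^ 2 + (DK τ κ - 1 - MK τ κ ^ 2 * G τ 0 0) * (1 + sK τ κ)) / DK τ κ := by
    rw [q0K, q1K, sK]; field_simp
  have e2 : MK τ κ ^ 2 * κ ^ 2 * G τ 0 1 ^ 2 + (DK τ κ - 1 - MK τ κ ^ 2 * G τ 0 0) * (1 + sK τ κ) =
      sK τ κ * DK τ κ := by rw [DK]; ring
  rw [e, e2, mul_div_assoc, mul_div_cancel_right₀ _ hD]
  linarith

/-- signs: `0 < q₀`, `0 ≤ q₁`, `0 < k₀`, `0 ≤ k₁`. [folklore] -/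
lemma k_signs : 0 < q0K τ κ ∧ 0 ≤ q1K τ κ ∧ 0 < k0K τ κ ∧ 0 ≤ k1K τ κ := by
  obtain ⟨hs0, hζ, -, hM⟩ := family_pos hτ (by linarith) hκ
  obtain ⟨-, -, -, hG⟩ := G_bounds hτ (by linarith)
  have hD := DK_pos hτ hτ1 hκ hs
  have hΔ := Δ_pos hτ (by linarith)
  have hq0 : 0 < q0K τ κ := by rw [q0K]; positivity
  have hq1 : 0 ≤ q1K τ κ := by
    rw [q1K, DK_sub_eq]; positivity
  exact ⟨hq0, hq1, by rw [k0K]; positivity, by rw [k1K]; positivity⟩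

/-- `MκG₀₁ = (4/3)(1 + s)` (divide `MζκG₀₁ = 4/5` by `ζ = (3/5)/(1+s)`). [folklore] -/
lemma MκB_eq : MK τ κ * κ * G τ 0 1 = 4 / 3 * (1 + sK τ κ) := by
  obtain ⟨r0, r1⟩ := family_id hτ hτ1 hκ hs
  have e : MK τ κ * κ * G τ 0 1 * (ζK τ κ * (1 + sK τ κ)) = 4 / 5 * (1 + sK τ κ) := by
    calc _ = MK τ κ * (ζK τ κ * κ * G τ 0 1) * (1 + sK τ κ) := by ring
      _ = _ := by rw [r0]
  rw [r1] at e
  linarith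

/-- `M²G₀₁ ≥ 1000`: the big coordinate dominates (`M²G₀₁ = (16/9)(1+s)²/(κ²G₀₁)`, `κ² ≤ s ≤ 10⁻³`). [folklore] -/
lemma MsqB_ge : 1000 ≤ MK τ κ ^ 2 * G τ 0 1 := by
  have hX := MκB_eq hτ hτ1 hκ hs
  obtain ⟨h11, h1101, h0100, h00, -⟩ := G_fine hτ hτ1
  have hκ2 := κ_sq_le hτ hτ1 (κ := κ)
  have hs0 := sK_nonneg hτ (by linarith : τ ≤ 1 / 2) κ
  have hτ2 : τ ^ 2 ≤ 1 / 10000 := by nlinarith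
  have h1 : (16 : ℝ) / 9 ≤ (MK τ κ * κ * G τ 0 1) ^ 2 := by rw [hX]; nlinarith
  have h2 : κ ^ 2 * G τ 0 1 ≤ 1.001 / 1000 := by
    have a : κ ^ 2 * G τ 0 1 ≤ 1 / 1000 * (1 + 2 * τ ^ 2) :=
      mul_le_mul (by linarith) (by linarith) (by linarith) (by norm_num)
    nlinarith
  have h3 : (MK τ κ * κ * G τ 0 1) ^ 2 = MK τ κ ^ 2 * G τ 0 1 * (κ ^ 2 * G τ 0 1) := by ring
  have hG : 0 < G τ 0 1 := by linarith
  by_contra hlt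
  rw [not_le] at hlt
  have hpos : 0 ≤ MK τ κ ^ 2 * G τ 0 1 := by positivity
  have h4 : MK τ κ ^ 2 * G τ 0 1 * (κ ^ 2 * G τ 0 1) ≤ 1000 * (1.001 / 1000) :=
    mul_le_mul hlt.le h2 (by positivity) (by norm_num)
  nlinarith

/-- `k₁ ≤ k₀/1000`: `k₁/k₀ = (s + M²κ²Δ)/(M²G₀₁)`. [folklore] -/
lemma k1_le : k1K τ κ ≤ k0K τ κ / 1000 := by
  have hD := DK_pos hτ hτ1 hκ hs
  have hX := MκB_eq hτ hτ1 hκ hs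
  have hMB := MsqB_ge hτ hτ1 hκ hs
  obtain ⟨h11, h1101, h0100, h00, hΔ⟩ := G_fine hτ hτ1
  obtain ⟨hs0, hζ, -, hM⟩ := family_pos hτ (by linarith) hκ
  have hΔ0 := Δ_pos hτ (by linarith)
  have hτ2 : τ ^ 2 ≤ 1 / 10000 := by nlinarith
  -- `M²κ²Δ ≤ 2·10⁻⁴`
  have h1 : MK τ κ ^ 2 * κ ^ 2 * Δ τ ≤ 2 / 10000 := by
    have e : MK τ κ ^ 2 * κ ^ 2 * Δ τ * G τ 0 1 ^ 2 = (4 / 3 * (1 + sK τ κ)) ^ 2 * Δ τ := by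
      rw [← hX]; ring
    have h16 : (4 / 3 * (1 + sK τ κ)) ^ 2 * Δ τ ≤ 2 / 10000 := by
      have a : (4 / 3 * (1 + sK τ κ)) ^ 2 ≤ 2 := by nlinarith
      calc (4 / 3 * (1 + sK τ κ)) ^ 2 * Δ τ ≤ 2 * τ ^ 2 := mul_le_mul a hΔ hΔ0.le (by norm_num)
        _ ≤ 2 / 10000 := by linarith
    have hB1 : 1 ≤ G τ 0 1 ^ 2 := by nlinarith
    have hnn : (0 : ℝ) ≤ MK τ κ ^ 2 * κ ^ 2 * Δ τ := by positivity
    calc MK τ κ ^ 2 * κ ^ 2 * Δ τ ≤ MK τ κ ^ 2 * κ ^ 2 * Δ τ * G τ 0 1 ^ 2 :=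
          le_mul_of_one_le_right hnn hB1
      _ ≤ 2 / 10000 := by rw [e]; exact h16
  have key : sK τ κ + MK τ κ ^ 2 * κ ^ 2 * Δ τ ≤ MK τ κ ^ 2 * G τ 0 1 / 1000 := by linarith
  rw [k1K, k0K, q1K, q0K, DK_sub_eq]
  calc κ * (ζK τ κ * (sK τ κ + MK τ κ ^ 2 * κ ^ 2 * Δ τ) / DK τ κ)
        = κ * ζK τ κ * (sK τ κ + MK τ κ ^ 2 * κ ^ 2 * Δ τ) / DK τ κ := by ring
    _ ≤ κ * ζK τ κ * (MK τ κ ^ 2 * G τ 0 1 / 1000) / DK τ κ := by gcongr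
    _ = MK τ κ * (ζK τ κ * MK τ κ * κ * G τ 0 1 / DK τ κ) / 1000 := by ring

omit hκ hs in
/-- `G₀₀ ≤ (1 + τ²)G₀₁`. [folklore] -/
lemma G00_le_G01 : G τ 0 0 ≤ (1 + τ ^ 2) * G τ 0 1 := by
  simp only [G, wt_zero, wt_one]
  have h1 : (0 : ℝ) < 1 - τ * τ := by nlinarith
  have h3 : (0 : ℝ) < 1 - τ * (τ / 2) := by nlinarith
  have key : 1 - τ * (τ / 2) ≤ (1 + τ ^ 2) * (1 - τ * τ) := by
    nlinarith [mul_nonneg (sq_nonneg τ) (show (0 : ℝ) ≤ 1 / 2 - τ ^ 2 by nlinarith)]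
  rw [inv_eq_one_div, inv_eq_one_div, mul_one_div, div_le_div_iff₀ h1 h3, one_mul]
  exact key

/-- THE SCALE RELATION `0.997k₀ ≤ ζκ ≤ 1.002k₀` (`ζκ/k₀ = D/(M²G₀₁)`): `‖ℓ‖/‖g_{τ/2}‖ = ζκ` and the leading
coefficient `k₀` of `κ(x₀ − z)` agree to three digits. [folklore] -/
lemma E_bounds : 0.997 * k0K τ κ ≤ ζK τ κ * κ ∧ ζK τ κ * κ ≤ 1.002 * k0K τ κ := by
  have hD := DK_pos hτ hτ1 hκ hs
  have hX := MκB_eq hτ hτ1 hκ hs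
  have hMB := MsqB_ge hτ hτ1 hκ hs
  have hAB := G00_le_G01 hτ hτ1
  obtain ⟨h11, h1101, h0100, h00, hΔ⟩ := G_fine hτ hτ1
  obtain ⟨hs0, hζ, -, hM⟩ := family_pos hτ (by linarith) hκ
  have hτ2 : τ ^ 2 ≤ 1 / 10000 := by nlinarith
  have hE : 0 < ζK τ κ * κ := mul_pos hζ hκ
  have hP : MK τ κ ^ 2 * κ ^ 2 * G τ 0 1 ^ 2 = (4 / 3 * (1 + sK τ κ)) ^ 2 := by rw [← hX]; ring
  have ek : k0K τ κ = ζK τ κ * κ * (MK τ κ ^ 2 * G τ 0 1) / DK τ κ := by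
    rw [k0K, q0K]; ring
  have hDhi : DK τ κ ≤ 1.002 * (MK τ κ ^ 2 * G τ 0 1) := by
    have h1 : (1 + sK τ κ) * G τ 0 0 ≤ 1.002 * G τ 0 1 := by
      have a : (1 + sK τ κ) * G τ 0 0 ≤ 1.001 * ((1 + τ ^ 2) * G τ 0 1) :=
        mul_le_mul (by linarith) hAB (by linarith) (by norm_num)
      nlinarith
    rw [DK]
    nlinarith [mul_le_mul_of_nonneg_left h1 (sq_nonneg (MK τ κ))]
  have hDlo : 0.997 * (MK τ κ ^ 2 * G τ 0 1) ≤ DK τ κ := by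
    have hG0 : 0 < G τ 0 0 := by linarith
    rw [DK]
    have a : (4 / 3 * (1 + sK τ κ)) ^ 2 ≤ 1.7814 := by nlinarith
    nlinarith [mul_le_mul_of_nonneg_left h0100 (sq_nonneg (MK τ κ)),
      mul_nonneg hs0.le (by positivity : (0 : ℝ) ≤ 1 + MK τ κ ^ 2 * G τ 0 0)]
  constructor
  · rw [ek]
    calc 0.997 * (ζK τ κ * κ * (MK τ κ ^ 2 * G τ 0 1) / DK τ κ)
          = ζK τ κ * κ * (0.997 * (MK τ κ ^ 2 * G τ 0 1)) / DK τ κ := by ring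
      _ ≤ ζK τ κ * κ * DK τ κ / DK τ κ := by gcongr
      _ = ζK τ κ * κ := by field_simp
  · rw [ek, show 1.002 * (ζK τ κ * κ * (MK τ κ ^ 2 * G τ 0 1) / DK τ κ) =
        ζK τ κ * κ * (1.002 * (MK τ κ ^ 2 * G τ 0 1)) / DK τ κ by ring, le_div_iff₀ hD]
    exact mul_le_mul_of_nonneg_left hDhi hE.le

end letters

/-! ### B. The pivot vectors of the family state in closed form: `ℓ = ζκ·g_{τ/2}`, `[ ]⁻¹(x₀ − z) = q`,
`κ(x₀ − z) = k₀g_τ + k₁g_{τ/2}`, `π₀ = 2κ(x₀ − z) − ℓ` -/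

section vectors

variable {τ : ℝ} (hτ : 0 < τ) (hτ1 : τ ≤ 1 / 100) {κ : ℝ} (hκ : 0 < κ) (hs : sK τ κ ≤ 1 / 1000)
include hτ hτ1 hκ

/-- the bracket point of `V_{y(κ)}` at `x₀` is `z(κ)`: `bz = z(κ)`. [cite: Enflo2023, v2 (15) p.6] -/
lemma bz_K : bz (WK τ κ hτ (by linarith)) xD = zK τ κ := brInv_eq_of_isBracket (isBracket_K hτ hτ1 hκ)

/-- THE MINIMISER `ℓ = V†z = ζκ·g_{τ/2}` — it lies on the residual kernel vector alone. [cite: Enflo2023, v2 (14)–(16) p.5–6] -/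
lemma ba_K : ba (WK τ κ hτ (by linarith)) xD = ((ζK τ κ * κ : ℝ) : ℂ) • gv (wt τ 1) := by
  have hlt : τ < 1 := by linarith
  rw [ba, bz_K hτ hτ1 hκ, adjoint_eq hτ hlt (WK_intertwine hτ hlt κ), zK_zero, zero_mul, zero_smul, zero_add,
    zK_one, cf_WK_one, ← Complex.ofReal_mul]

/-- `‖ℓ‖ = ζκ‖g_{τ/2}‖`. [folklore] -/
lemma norm_ba_K : ‖ba (WK τ κ hτ (by linarith)) xD‖ = ζK τ κ * κ * ‖gv (wt τ 1)‖ := by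
  obtain ⟨-, hζ, -, -⟩ := family_pos hτ (by linarith) hκ
  rw [ba_K hτ hτ1 hκ, norm_smul, Complex.norm_real, Real.norm_of_nonneg (mul_pos hζ hκ).le]

include hs

/-- `q` IS THE BRACKET POINT OF THE PIVOT VECTOR: `q + WW†q = x₀ − z`. [cite: Enflo2023, v2 (13)–(15) p.6] -/
lemma isBracket_q : IsBracket (WK τ κ hτ (by linarith)) (xD - zK τ κ) (qK τ κ) := by
  have hlt : τ < 1 := by linarith
  have hK := K_apply hτ hlt (WK_intertwine hτ hlt κ) (qK τ κ)
  have r0 : q0K τ κ + MK τ κ * (q0K τ κ * MK τ κ * G τ 0 0 + q1K τ κ * κ * G τ 0 1) = 4 / 5 := by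
    linear_combination q_row0 hτ hτ1 hκ hs
  have r1 : q1K τ κ + κ * (q0K τ κ * MK τ κ * G τ 0 1 + q1K τ κ * κ * G τ 1 1) = 3 / 5 - ζK τ κ := by
    linear_combination q_row1 hτ hτ1 hκ hs
  show qK τ κ + WK τ κ hτ hlt (adjoint (WK τ κ hτ hlt) (qK τ κ)) = xD - zK τ κ
  ext i
  fin_cases i
  · show qK τ κ 0 + WK τ κ hτ hlt (adjoint (WK τ κ hτ hlt) (qK τ κ)) 0 = xD 0 - zK τ κ 0
    rw [hK, qK_zero, qK_one, xD_zero, zK_zero, cf_WK_zero, cf_WK_one, Complex.conj_ofReal, sub_zero]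
    simp only [← Complex.ofReal_mul, ← Complex.ofReal_add]
    rw [r0]
  · show qK τ κ 1 + WK τ κ hτ hlt (adjoint (WK τ κ hτ hlt) (qK τ κ)) 1 = xD 1 - zK τ κ 1
    rw [hK, qK_zero, qK_one, xD_one, zK_one, cf_WK_zero, cf_WK_one, Complex.conj_ofReal, G_symm τ 1 0]
    simp only [← Complex.ofReal_mul, ← Complex.ofReal_add, ← Complex.ofReal_sub]
    rw [r1]

/-- `[ ]⁻¹(x₀ − z) = q`. [cite: Enflo2023, v2 (15) p.6] -/
lemma brInv_K : brInv (WK τ κ hτ (by linarith)) (xD - zK τ κ) = qK τ κ :=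
  brInv_eq_of_isBracket (isBracket_q hτ hτ1 hκ hs)

/-- THE SIDE-CONDITION VECTOR `κ(x₀ − z) = W†[ ]⁻¹(x₀ − z) = k₀g_τ + k₁g_{τ/2}` — it lies (to three digits) on the
OTHER kernel vector `g_τ`. [cite: Enflo2023, v2 (36) p.16] -/
lemma bκ_K : bκ (WK τ κ hτ (by linarith)) (xD - zK τ κ) =
    ((k0K τ κ : ℝ) : ℂ) • gv (wt τ 0) + ((k1K τ κ : ℝ) : ℂ) • gv (wt τ 1) := by
  have hlt : τ < 1 := by linarith
  rw [bκ, brInv_K hτ hτ1 hκ hs, adjoint_eq hτ hlt (WK_intertwine hτ hlt κ), qK_zero, qK_one, cf_WK_zero,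
    cf_WK_one, k0K, k1K]
  push_cast
  rw [mul_comm (MK τ κ : ℂ), mul_comm (κ : ℂ)]

/-- THE DECREASE VECTOR `π₀ = 2κ(x₀ − z) − ℓ = 2k₀g_τ + (2k₁ − ζκ)g_{τ/2}`. [cite: Enflo2023, v2 (31), (37) p.16] -/
lemma bπ_K : bπ (WK τ κ hτ (by linarith)) xD 0 0 =
    ((2 * k0K τ κ : ℝ) : ℂ) • gv (wt τ 0) + ((2 * k1K τ κ - ζK τ κ * κ : ℝ) : ℂ) • gv (wt τ 1) := by
  rw [bπ_zero_eq, bz_K hτ hτ1 hκ, bκ_K hτ hτ1 hκ hs, ba_K hτ hτ1 hκ, smul_add, smul_smul, smul_smul]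
  push_cast
  rw [sub_smul, two_mul, two_mul]
  abel

/-- `κ(x₀ − z) ≠ 0` (its `g_τ`-pairing is `k₀G₀₀ + k₁G₀₁ > 0`). [folklore] -/
lemma bκ_K_ne_zero : bκ (WK τ κ hτ (by linarith)) (xD - zK τ κ) ≠ 0 := by
  have hlt : τ < 1 := by linarith
  obtain ⟨-, -, hk0, hk1⟩ := k_signs hτ hτ1 hκ hs
  obtain ⟨h11, h1101, h0100, -⟩ := G_fine hτ hτ1
  intro h
  have h1 : ⟪gv (wt τ 0), bκ (WK τ κ hτ hlt) (xD - zK τ κ)⟫_ℂ = ((k0K τ κ * G τ 0 0 + k1K τ κ * G τ 0 1 : ℝ) : ℂ) := by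
    rw [bκ_K hτ hτ1 hκ hs, inner_add_right, inner_smul_right, inner_smul_right, inner_gv_wt hτ hlt,
      inner_gv_wt hτ hlt]
    push_cast; ring
  rw [h, inner_zero_right] at h1
  have h2 : k0K τ κ * G τ 0 0 + k1K τ κ * G τ 0 1 = 0 := by exact_mod_cast h1.symm
  nlinarith [mul_pos hk0 (show 0 < G τ 0 0 by linarith), mul_nonneg hk1 (show 0 ≤ G τ 0 1 by linarith)]

/-- `‖κ(x₀ − z)‖·‖g_{τ/2}‖ ≤ 1.01k₀` (`‖κ‖ ≤ k₀‖g_τ‖ + k₁‖g_{τ/2}‖`, `‖g_τ‖‖g_{τ/2}‖ ≤ (G₀₀ + G₁₁)/2 ≤ 1.0002`). [folklore] -/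
lemma norm_bκ_K_le : ‖gv (wt τ 1)‖ * ‖bκ (WK τ κ hτ (by linarith)) (xD - zK τ κ)‖ ≤ 1.01 * k0K τ κ := by
  have hlt : τ < 1 := by linarith
  obtain ⟨-, -, hk0, hk1⟩ := k_signs hτ hτ1 hκ hs
  obtain ⟨h11, h1101, h0100, h00, -⟩ := G_fine hτ hτ1
  have hk1le := k1_le hτ hτ1 hκ hs
  have hτ2 : τ ^ 2 ≤ 1 / 10000 := by nlinarith
  have hA : ‖gv (wt τ 0)‖ ^ 2 = G τ 0 0 := by rw [norm_gv_sq (abs_wt_lt hτ hlt 0), G]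
  have hC : ‖gv (wt τ 1)‖ ^ 2 = G τ 1 1 := by rw [norm_gv_sq (abs_wt_lt hτ hlt 1), G]
  have h1 : ‖bκ (WK τ κ hτ hlt) (xD - zK τ κ)‖ ≤ k0K τ κ * ‖gv (wt τ 0)‖ + k1K τ κ * ‖gv (wt τ 1)‖ := by
    rw [bκ_K hτ hτ1 hκ hs]
    refine (norm_add_le _ _).trans (le_of_eq ?_)
    rw [norm_smul, norm_smul, Complex.norm_real, Complex.norm_real, Real.norm_of_nonneg hk0.le,
      Real.norm_of_nonneg hk1]
  have hg0 := norm_nonneg (gv (wt τ 0))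
  have hg1 := norm_nonneg (gv (wt τ 1))
  have h2 : ‖gv (wt τ 0)‖ * ‖gv (wt τ 1)‖ ≤ 1.0002 := by nlinarith [sq_nonneg (‖gv (wt τ 0)‖ - ‖gv (wt τ 1)‖)]
  have h3 : ‖gv (wt τ 1)‖ * ‖gv (wt τ 1)‖ ≤ 1.0002 := by nlinarith
  calc ‖gv (wt τ 1)‖ * ‖bκ (WK τ κ hτ hlt) (xD - zK τ κ)‖
        ≤ ‖gv (wt τ 1)‖ * (k0K τ κ * ‖gv (wt τ 0)‖ + k1K τ κ * ‖gv (wt τ 1)‖) :=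
          mul_le_mul_of_nonneg_left h1 hg1
    _ = k0K τ κ * (‖gv (wt τ 0)‖ * ‖gv (wt τ 1)‖) + k1K τ κ * (‖gv (wt τ 1)‖ * ‖gv (wt τ 1)‖) := by ring
    _ ≤ k0K τ κ * 1.0002 + k0K τ κ / 1000 * 1.0002 := by gcongr
    _ ≤ 1.01 * k0K τ κ := by linarith

end vectors

/-! ### C. The three-parameter directions `N = X·1 + (Y + iZ)·S ∈ {S}'` and their first-order functionals -/

section directions

variable {τ : ℝ}

/-- THE DIRECTIONS `N = X·1 + (Y + iZ)·S` — complex degree-one polynomials in the shift (the text's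
`y → y + r(T)y`, `r` linear with a complex slope). [cite: Enflo2023, v2 p.16 (`T^j(y' + r(T)y')`)] -/
def Ndir3 (X Y Z : ℝ) : ℓ2 →L[ℂ] ℓ2 :=
  ((X : ℝ) : ℂ) • (1 : ℓ2 →L[ℂ] ℓ2) + (((Y : ℝ) : ℂ) + ((Z : ℝ) : ℂ) * I) • S

/-- `N b = Xb + (Y + iZ)Sb`. [folklore] -/
lemma Ndir3_apply (X Y Z : ℝ) (b : ℓ2) :
    Ndir3 X Y Z b = ((X : ℝ) : ℂ) • b + (((Y : ℝ) : ℂ) + ((Z : ℝ) : ℂ) * I) • S b := by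
  rw [Ndir3, add_apply, smul_apply, smul_apply, one_apply_eq_self]

/-- `N` commutes with `S`. [folklore] -/
lemma Ndir3_comm (X Y Z : ℝ) : Ndir3 X Y Z ∘L S = S ∘L Ndir3 X Y Z := by
  refine ContinuousLinearMap.ext fun b => ?_
  rw [comp_apply, comp_apply, Ndir3_apply, Ndir3_apply, map_add, map_smul, map_smul]

/-- the direction as an element of the commutant `{S}'`. [folklore] -/
def pdir3 (X Y Z : ℝ) : Comm (S : ℓ2 →L[ℂ] ℓ2) := ⟨Ndir3 X Y Z, Ndir3_comm X Y Z⟩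

/-- `ιS S (pdir3 X Y Z) = N`. [folklore] -/
lemma ιS_pdir3 (X Y Z : ℝ) : ιS S (pdir3 X Y Z) = Ndir3 X Y Z := rfl

/-- `‖N‖ ≤ |X| + |Y| + |Z|` (`‖S‖ ≤ 1`). [folklore] -/
lemma norm_pdir3_le (X Y Z : ℝ) : ‖pdir3 X Y Z‖ ≤ |X| + |Y| + |Z| := by
  show ‖Ndir3 X Y Z‖ ≤ _
  have h0 : ‖(1 : ℓ2 →L[ℂ] ℓ2)‖ ≤ 1 := by rw [one_def]; exact norm_id_le
  have h1 : ‖((X : ℝ) : ℂ) • (1 : ℓ2 →L[ℂ] ℓ2)‖ ≤ |X| := by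
    rw [norm_smul, Complex.norm_real, Real.norm_eq_abs]
    exact mul_le_of_le_one_right (abs_nonneg _) h0
  have h2 : ‖(((Y : ℝ) : ℂ) + ((Z : ℝ) : ℂ) * I) • (S : ℓ2 →L[ℂ] ℓ2)‖ ≤ |Y| + |Z| := by
    rw [norm_smul]
    have h3 : ‖((Y : ℝ) : ℂ) + ((Z : ℝ) : ℂ) * I‖ ≤ |Y| + |Z| := by
      refine (norm_add_le _ _).trans ?_
      rw [Complex.norm_real, norm_mul, Complex.norm_real, Complex.norm_I, mul_one, Real.norm_eq_abs,
        Real.norm_eq_abs]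
    calc _ ≤ (|Y| + |Z|) * 1 := mul_le_mul h3 norm_S_le (norm_nonneg _) (by positivity)
      _ = |Y| + |Z| := mul_one _
  rw [add_assoc]
  exact (norm_add_le _ _).trans (add_le_add h1 h2)

/-- `⟪g_μ, Nb⟫ = (X + (Y + iZ)μ)⟪g_μ, b⟫` (`g_μ` is an eigenvector of `N†`). [folklore] -/
lemma inner_gv_Ndir3 {μ : ℝ} (hμ : |μ| < 1) (X Y Z : ℝ) (b : ℓ2) :
    ⟪gv μ, Ndir3 X Y Z b⟫_ℂ = (((X : ℝ) : ℂ) + (((Y : ℝ) : ℂ) + ((Z : ℝ) : ℂ) * I) * (μ : ℂ)) * ⟪gv μ, b⟫_ℂ := by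
  rw [Ndir3_apply, inner_add_right, inner_smul_right, inner_smul_right, inner_gv_S hμ]
  ring

/-- THE MATRIX ELEMENTS OF `Lin N = N + N†` between kernel vectors:
`⟪g_μ, (N + N†)g_ν⟫ = (2X + Y(μ + ν) + iZ(μ − ν))⟪g_μ, g_ν⟫`. [cite: Enflo2023, v2 (36)–(37) p.16] -/
lemma inner_gv_Lin_gv {μ ν : ℝ} (hμ : |μ| < 1) (hν : |ν| < 1) (X Y Z : ℝ) :
    ⟪gv μ, Lin (Ndir3 X Y Z) (gv ν)⟫_ℂ =
      ⟪gv μ, gv ν⟫_ℂ * (((2 * X + Y * (μ + ν) : ℝ) : ℂ) + ((Z * (μ - ν) : ℝ) : ℂ) * I) := by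
  rw [Lin, add_apply, inner_add_right, adjoint_inner_right, ← inner_conj_symm (Ndir3 X Y Z (gv μ)) (gv ν),
    inner_gv_Ndir3 hμ, inner_gv_Ndir3 hν, map_mul, inner_conj_symm]
  simp only [map_add, map_mul, Complex.conj_ofReal, Complex.conj_I]
  push_cast
  ring

end directions

/-! ### D. The first-order pair `Λfκ` of a direction at the family state, in closed form -/

section functionals

variable {τ : ℝ} (hτ : 0 < τ) (hτ1 : τ ≤ 1 / 100) {κ : ℝ} (hκ : 0 < κ) (hs : sK τ κ ≤ 1 / 1000)
include hτ hτ1 hκ hs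

/-- THE SIDE-CONDITION FUNCTIONAL (46) of `N = X + (Y + iZ)S` at the pivot `x₀ − z`:
`⟪κ(x₀ − z), (N + N†)ℓ⟫ = ζκ[k₀G₀₁(2X + (3τ/2)Y + i(τ/2)Z) + k₁G₁₁(2X + τY)]`. [cite: Enflo2023, v2 (36), (46) p.16–19] -/
lemma side_inner (X Y Z : ℝ) :
    ⟪bκ (WK τ κ hτ (by linarith)) (xD - zK τ κ), Lin (Ndir3 X Y Z) (ba (WK τ κ hτ (by linarith)) xD)⟫_ℂ =
      ((ζK τ κ * κ * (k0K τ κ * G τ 0 1 * (2 * X + 3 / 2 * τ * Y) + k1K τ κ * G τ 1 1 * (2 * X + τ * Y)) : ℝ) : ℂ)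
        + ((ζK τ κ * κ * (k0K τ κ * G τ 0 1 * (τ / 2 * Z)) : ℝ) : ℂ) * I := by
  have hlt : τ < 1 := by linarith
  rw [bκ_K hτ hτ1 hκ hs, ba_K hτ hτ1 hκ, map_smul, inner_smul_right, inner_add_left, inner_smul_left,
    inner_smul_left, inner_gv_Lin_gv (abs_wt_lt hτ hlt 0) (abs_wt_lt hτ hlt 1),
    inner_gv_Lin_gv (abs_wt_lt hτ hlt 1) (abs_wt_lt hτ hlt 1), inner_gv_wt hτ hlt, inner_gv_wt hτ hlt,
    Complex.conj_ofReal, Complex.conj_ofReal, wt_zero, wt_one]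
  push_cast
  ring

/-- THE DECREASE FUNCTIONAL (b′) of `N` : `⟪π₀, (N + N†)ℓ⟫ = ζκ[2k₀G₀₁(2X + (3τ/2)Y + i(τ/2)Z) + (2k₁ − ζκ)G₁₁(2X + τY)]`.
[cite: Enflo2023, v2 (37), (b′) p.16–17] -/
lemma dec_inner (X Y Z : ℝ) :
    ⟪bπ (WK τ κ hτ (by linarith)) xD 0 0, Lin (Ndir3 X Y Z) (ba (WK τ κ hτ (by linarith)) xD)⟫_ℂ =
      ((ζK τ κ * κ * (2 * k0K τ κ * G τ 0 1 * (2 * X + 3 / 2 * τ * Y)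
          + (2 * k1K τ κ - ζK τ κ * κ) * G τ 1 1 * (2 * X + τ * Y)) : ℝ) : ℂ)
        + ((ζK τ κ * κ * (2 * k0K τ κ * G τ 0 1 * (τ / 2 * Z)) : ℝ) : ℂ) * I := by
  have hlt : τ < 1 := by linarith
  rw [bπ_K hτ hτ1 hκ hs, ba_K hτ hτ1 hκ, map_smul, inner_smul_right, inner_add_left, inner_smul_left,
    inner_smul_left, inner_gv_Lin_gv (abs_wt_lt hτ hlt 0) (abs_wt_lt hτ hlt 1),
    inner_gv_Lin_gv (abs_wt_lt hτ hlt 1) (abs_wt_lt hτ hlt 1), inner_gv_wt hτ hlt, inner_gv_wt hτ hlt,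
    Complex.conj_ofReal, Complex.conj_ofReal, wt_zero, wt_one]
  push_cast
  ring

/-- THE FIRST-ORDER PAIR OF `N = X + (Y + iZ)S` AT THE FAMILY STATE, componentwise (real part of the side
functional, imaginary part, decrease), with `n = ‖κ(x₀ − z)‖`, `γ = ‖g_{τ/2}‖`:
`Re = −[k₀G₀₁(2X + 1.5τY) + k₁G₁₁(2X + τY)]/(γn)`, `Im = −k₀G₀₁(τ/2)Z/(γn)`,
`dec = −[2k₀G₀₁(2X + 1.5τY) + (2k₁ − ζκ)G₁₁(2X + τY)]/(ζκG₁₁)`. [cite: Enflo2023, v2 (36)–(37) p.16] -/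
lemma Λfκ_K (X Y Z : ℝ) :
    (Λfκ (WK τ κ hτ (by linarith)) xD (xD - zK τ κ) (Ndir3 X Y Z)).1.re =
        -(k0K τ κ * G τ 0 1 * (2 * X + 3 / 2 * τ * Y) + k1K τ κ * G τ 1 1 * (2 * X + τ * Y)) /
          (‖gv (wt τ 1)‖ * ‖bκ (WK τ κ hτ (by linarith)) (xD - zK τ κ)‖) ∧
      (Λfκ (WK τ κ hτ (by linarith)) xD (xD - zK τ κ) (Ndir3 X Y Z)).1.im =
        -(k0K τ κ * G τ 0 1 * (τ / 2 * Z)) / (‖gv (wt τ 1)‖ * ‖bκ (WK τ κ hτ (by linarith)) (xD - zK τ κ)‖) ∧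
      (Λfκ (WK τ κ hτ (by linarith)) xD (xD - zK τ κ) (Ndir3 X Y Z)).2 =
        -(2 * k0K τ κ * G τ 0 1 * (2 * X + 3 / 2 * τ * Y) + (2 * k1K τ κ - ζK τ κ * κ) * G τ 1 1 * (2 * X + τ * Y)) /
          (ζK τ κ * κ * G τ 1 1) := by
  have hlt : τ < 1 := by linarith
  obtain ⟨-, hζ, -, -⟩ := family_pos hτ (by linarith) hκ
  have hE : 0 < ζK τ κ * κ := mul_pos hζ hκ
  have hg1 : 0 < ‖gv (wt τ 1)‖ := lt_of_lt_of_le one_pos (one_le_norm_gv (abs_wt_lt hτ hlt 1))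
  have hn : 0 < ‖bκ (WK τ κ hτ hlt) (xD - zK τ κ)‖ := norm_pos_iff.2 (bκ_K_ne_zero hτ hτ1 hκ hs)
  have hC : ‖gv (wt τ 1)‖ ^ 2 = G τ 1 1 := by rw [norm_gv_sq (abs_wt_lt hτ hlt 1), G]
  refine ⟨?_, ?_, ?_⟩
  · rw [Λfκ]
    dsimp only
    rw [side_inner hτ hτ1 hκ hs, norm_ba_K hτ hτ1 hκ, Complex.div_ofReal_re]
    simp only [Complex.neg_re, Complex.add_re, Complex.ofReal_re, Complex.mul_re, Complex.ofReal_im,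
      Complex.I_re, Complex.I_im, mul_zero, add_zero, mul_one, sub_self]
    field_simp
  · rw [Λfκ]
    dsimp only
    rw [side_inner hτ hτ1 hκ hs, norm_ba_K hτ hτ1 hκ, Complex.div_ofReal_im]
    simp only [Complex.neg_im, Complex.add_im, Complex.ofReal_im, Complex.mul_im, Complex.ofReal_re,
      Complex.I_re, Complex.I_im, mul_zero, zero_add, add_zero, mul_one]
    field_simp
  · rw [Λfκ]
    dsimp only
    rw [dec_inner hτ hτ1 hκ hs, norm_ba_K hτ hτ1 hκ]
    simp only [Complex.add_re, Complex.ofReal_re, Complex.mul_re, Complex.ofReal_im, Complex.I_re,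
      Complex.I_im, mul_zero, add_zero, mul_one, sub_self]
    rw [mul_pow, hC]
    field_simp

end functionals

/-! ### E. (34) at every state of the family, with ONE FIXED modulus `σ ≤ τ/12` -/

section indep

variable {τ : ℝ} (hτ : 0 < τ) (hτ1 : τ ≤ 1 / 100) {κ : ℝ} (hκ : 0 < κ) (hs : sK τ κ ≤ 1 / 1000)
include hτ hτ1 hκ hs

/-- (34) IN THE INTRINSIC TWO-FOLD FORM HOLDS AT EVERY STATE `V_{y(κ)}` OF THE FAMILY (`s(κ) ≤ 1/1000`) WITH
THE FIXED MODULUS `σ ≤ τ/12`: every target pair `t` (side effect in units of `‖ℓ‖‖κ(x₀ − z)‖`, decrease in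
units of `(εθ)`) is the first-order effect of a direction `N = X + (Y + iZ)S ∈ {S}'` with
`‖N‖ ≤ |X| + |Y| + |Z| ≤ 12‖t‖/τ ≤ ‖t‖/σ`.  The three real parameters are solved for explicitly from the
closed forms of `Λfκ_K` (a nonsingular triangular `3 × 3` system in `(2X + 1.5τY, 2X + τY, (τ/2)Z)`); the cost
`12/τ` is uniform in `κ → 0`, i.e. in `(εθ) → 0`. [cite: Enflo2023, v2 (34)–(38) p.16–17, p.19 L656–L677] -/
theorem indepBrκ_K {σ : ℝ} (hσ : 0 < σ) (hστ : σ ≤ τ / 12) :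
    IndepBrκ (WK τ κ hτ (by linarith)) xD (xD - zK τ κ) (ιS S) σ := by
  have hlt : τ < 1 := by linarith
  obtain ⟨-, hζ, -, -⟩ := family_pos hτ (by linarith) hκ
  obtain ⟨-, -, hk0, hk1⟩ := k_signs hτ hτ1 hκ hs
  obtain ⟨hC1, hCB, hBA, hAu, -⟩ := G_fine hτ hτ1
  have hk1le := k1_le hτ hτ1 hκ hs
  have hτ2 : τ ^ 2 ≤ 1 / 10000 := by nlinarith
  have hB1 : 1 ≤ G τ 0 1 := hC1.trans hCB
  have hCu : G τ 1 1 ≤ 1.0002 := by linarith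
  have hγ1 : 1 ≤ ‖gv (wt τ 1)‖ := one_le_norm_gv (abs_wt_lt hτ hlt 1)
  have hn : 0 < ‖bκ (WK τ κ hτ hlt) (xD - zK τ κ)‖ := norm_pos_iff.2 (bκ_K_ne_zero hτ hτ1 hκ hs)
  -- the two intrinsic scales `E = ζκ` (`‖ℓ‖ = E‖g_{τ/2}‖`) and `Γ = ‖g_{τ/2}‖‖κ(x₀ − z)‖`
  obtain ⟨E, hE⟩ : ∃ E, E = ζK τ κ * κ := ⟨_, rfl⟩
  obtain ⟨hEl, hEu⟩ := E_bounds hτ hτ1 hκ hs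
  rw [← hE] at hEl hEu
  have hE0 : 0 < E := by rw [hE]; exact mul_pos hζ hκ
  obtain ⟨Γ, hΓ⟩ : ∃ Γ, Γ = ‖gv (wt τ 1)‖ * ‖bκ (WK τ κ hτ hlt) (xD - zK τ κ)‖ := ⟨_, rfl⟩
  have hΓ0 : 0 < Γ := by rw [hΓ]; exact mul_pos (by linarith) hn
  have hΓu : Γ ≤ 1.01 * k0K τ κ := by rw [hΓ]; exact norm_bκ_K_le hτ hτ1 hκ hs
  have hEC : 0 < E * G τ 1 1 := by positivity
  have hk0B : 0 < k0K τ κ * G τ 0 1 := by positivity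
  have hEC_ge : 0.997 * k0K τ κ ≤ E * G τ 1 1 := hEl.trans (le_mul_of_one_le_right hE0.le hC1)
  have hk0B_ge : k0K τ κ ≤ k0K τ κ * G τ 0 1 := le_mul_of_one_le_right hk0.le hB1
  intro t
  have hm0 : 0 ≤ ‖t‖ := norm_nonneg t
  have hr : |t.1.re| ≤ ‖t‖ := (Complex.abs_re_le_norm _).trans (norm_fst_le t)
  have hj : |t.1.im| ≤ ‖t‖ := (Complex.abs_im_le_norm _).trans (norm_fst_le t)
  have hd : |t.2| ≤ ‖t‖ := by have h := norm_snd_le t; rwa [Real.norm_eq_abs] at h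
  have hrΓ : |t.1.re| * Γ ≤ ‖t‖ * (1.01 * k0K τ κ) := mul_le_mul hr hΓu hΓ0.le hm0
  have hjΓ : |t.1.im| * Γ ≤ ‖t‖ * (1.01 * k0K τ κ) := mul_le_mul hj hΓu hΓ0.le hm0
  -- the explicit solution of the triangular system
  obtain ⟨a₁, ha₁⟩ : ∃ a, a = t.2 - 2 * t.1.re * Γ / (E * G τ 1 1) := ⟨_, rfl⟩
  obtain ⟨a₀, ha₀⟩ : ∃ a, a = (-(t.1.re * Γ) - k1K τ κ * G τ 1 1 * a₁) / (k0K τ κ * G τ 0 1) := ⟨_, rfl⟩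
  obtain ⟨X, hX⟩ : ∃ a, a = (3 * a₁ - 2 * a₀) / 2 := ⟨_, rfl⟩
  obtain ⟨Y, hY⟩ : ∃ a, a = 2 * (a₀ - a₁) / τ := ⟨_, rfl⟩
  obtain ⟨Z, hZ⟩ : ∃ a, a = -(2 * t.1.im * Γ) / (k0K τ κ * G τ 0 1) / τ := ⟨_, rfl⟩
  -- the bounds `|a₁| ≤ 3.1‖t‖`, `|a₀| ≤ 1.1‖t‖`, `|X| ≤ 6‖t‖`, `|Y| ≤ 8.4‖t‖/τ`, `|Z| ≤ 2.1‖t‖/τ`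
  have hq1 : |2 * t.1.re * Γ / (E * G τ 1 1)| ≤ 2.1 * ‖t‖ := by
    rw [abs_div, abs_of_pos hEC, div_le_iff₀ hEC, abs_mul, abs_mul, abs_two, abs_of_pos hΓ0]
    linarith [mul_le_mul_of_nonneg_left hEC_ge (by positivity : (0 : ℝ) ≤ 2.1 * ‖t‖),
      mul_nonneg hm0 hk0.le]
  have hA1 : |a₁| ≤ 3.1 * ‖t‖ := by
    obtain ⟨hd1, hd2⟩ := abs_le.1 hd
    obtain ⟨hq1a, hq1b⟩ := abs_le.1 hq1
    rw [ha₁, abs_le]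
    constructor <;> linarith
  have hkC : k1K τ κ * G τ 1 1 ≤ k0K τ κ / 1000 * 1.0002 := mul_le_mul hk1le hCu (by linarith) (by positivity)
  have hkCa : |k1K τ κ * G τ 1 1 * a₁| ≤ k0K τ κ / 1000 * 1.0002 * (3.1 * ‖t‖) := by
    rw [abs_mul, abs_of_nonneg (by positivity : 0 ≤ k1K τ κ * G τ 1 1)]
    exact mul_le_mul hkC hA1 (abs_nonneg _) (by positivity)
  have hrΓ' : |t.1.re * Γ| ≤ ‖t‖ * (1.01 * k0K τ κ) := by rwa [abs_mul, abs_of_pos hΓ0]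
  have hA0 : |a₀| ≤ 1.1 * ‖t‖ := by
    rw [ha₀, abs_div, abs_of_pos hk0B, div_le_iff₀ hk0B]
    obtain ⟨h1, h2⟩ := abs_le.1 hrΓ'
    obtain ⟨h3, h4⟩ := abs_le.1 hkCa
    have h5 := mul_le_mul_of_nonneg_left hk0B_ge hm0
    rw [abs_le]
    constructor <;> linarith
  have hXb : |X| ≤ 6 * ‖t‖ := by
    obtain ⟨h1, h2⟩ := abs_le.1 hA1
    obtain ⟨h3, h4⟩ := abs_le.1 hA0
    rw [hX, abs_le]
    constructor <;> linarith
  have hYb : |Y| ≤ 8.4 * (‖t‖ / τ) := by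
    obtain ⟨h1, h2⟩ := abs_le.1 hA1
    obtain ⟨h3, h4⟩ := abs_le.1 hA0
    rw [← mul_div_assoc, hY, abs_div, abs_of_pos hτ]
    refine div_le_div_of_nonneg_right ?_ hτ.le
    rw [abs_le]
    constructor <;> linarith
  have hZb : |Z| ≤ 2.1 * (‖t‖ / τ) := by
    rw [← mul_div_assoc, hZ, abs_div, abs_of_pos hτ]
    refine div_le_div_of_nonneg_right ?_ hτ.le
    rw [abs_div, abs_of_pos hk0B, div_le_iff₀ hk0B, abs_neg, abs_mul, abs_mul, abs_two, abs_of_pos hΓ0]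
    linarith [mul_le_mul_of_nonneg_left hk0B_ge hm0, mul_nonneg hm0 hk0.le]
  have hXτ : 6 * ‖t‖ ≤ 1.5 * (‖t‖ / τ) := by
    rw [← mul_div_assoc, le_div_iff₀ hτ]
    linarith [mul_le_mul_of_nonneg_left hτ1 hm0]
  refine ⟨pdir3 X Y Z, ?_, ?_⟩
  · -- the three equations
    have hγ0 : ‖gv (wt τ 1)‖ ≠ 0 := by linarith
    have hn0 : ‖bκ (WK τ κ hτ hlt) (xD - zK τ κ)‖ ≠ 0 := hn.ne'
    have hζ0 : ζK τ κ ≠ 0 := hζ.ne'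
    have hκ0 : κ ≠ 0 := hκ.ne'
    have hC0 : G τ 1 1 ≠ 0 := by linarith
    have hB0 : G τ 0 1 ≠ 0 := by linarith
    have hk00 : k0K τ κ ≠ 0 := hk0.ne'
    have hτ0 : τ ≠ 0 := hτ.ne'
    obtain ⟨e1, e2, e3⟩ := Λfκ_K hτ hτ1 hκ hs X Y Z
    rw [ιS_pdir3]
    subst hX hY hZ ha₀ ha₁ hΓ hE
    refine Prod.ext (Complex.ext_iff.2 ⟨?_, ?_⟩) ?_
    · rw [e1]
      field_simp
      ring
    · rw [e2]
      field_simp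
    · rw [e3]
      field_simp
      ring
  · -- the cost
    calc ‖pdir3 X Y Z‖ ≤ |X| + |Y| + |Z| := norm_pdir3_le X Y Z
      _ ≤ 12 * (‖t‖ / τ) := by linarith
      _ ≤ ‖t‖ / σ := by
          rw [← mul_div_assoc, div_le_div_iff₀ hτ hσ]
          linarith [mul_le_mul_of_nonneg_left hστ hm0]

end indep

/-! ### F. Along the scheduled run of `StepRealisationDiagLow`: (34) at every state, one fixed modulus, and the
orbit-restricted form of the record's `IndepRunD` -/

section orbit

variable {τ : ℝ} (hτ : 0 < τ) (hτ1 : τ ≤ 1 / 100)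
include hτ hτ1

/-- (34) AT THE FAMILY STATE as the record's state-level predicate `IndepAtκ` (pivot `c = x₀ − v`, direction
space `{S}'`, modulus `σ ≤ τ/12`). [cite: Enflo2023, v2 (34), (36)–(38) p.16–17] -/
theorem indepAtκ_stK {κ : ℝ} (hκ : 0 < κ) (hs : sK τ κ ≤ 1 / 1000) (hs1 : sK τ κ ≤ 1) {σ : ℝ} (hσ : 0 < σ)
    (hστ : σ ≤ τ / 12) : IndepAtκ (ιS S) σ (stK hτ hτ1 κ hκ hs1) (xD - (stK hτ hτ1 κ hκ hs1).v) := by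
  rw [IndepAtκ, Wn_stK, stK_v]
  exact indepBrκ_K hτ hτ1 hκ hs hσ hστ

variable {β : ℝ} (hβ0 : 0 < β) (hβ1 : β ≤ 1 / 1000)
include hβ0 hβ1

/-- **(34) HOLDS AT EVERY STATE OF THE SCHEDULED RUN WITH ONE FIXED MODULUS `σ ≤ τ/12`** — although
`(εθ)_n = (1−β)ⁿ(εθ)₀ → 0` (`fK_etheta`): in the type-1 model the cost of the targeted step in units of the
intrinsic scales stays `≤ 12/τ`, it does NOT blow up like `(εθ)_n^{-1/2}` (contrast `StepRealisationOrbit`'s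
`indepRunκ_etheta_floor`, whose floor needs the pivot-INDEPENDENT form). [cite: Enflo2023, v2 (34) p.16, p.19 L656–L677] -/
theorem fK_indepAtκ {σ : ℝ} (hσ : 0 < σ) (hστ : σ ≤ τ / 12) (n : ℕ) :
    IndepAtκ (ιS S) σ (fK hτ hτ1 hβ0 hβ1 n) (xD - (fK hτ hτ1 hβ0 hβ1 n).v) :=
  indepAtκ_stK hτ hτ1 (κseq_pos hτ hτ1 hβ0 hβ1 n) ((sK_κseq_le_β hτ hτ1 hβ0 hβ1 n).trans hβ1) _ hσ hστ

/-- ON THE RUN THE EPOCH INVARIANT IS DIAGONAL: `InvP C s_m (x₀ − v_m) s_n` forces `n = m`, because the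
accumulated side condition `⟨x₀ − v_m, v_n − v_m⟩ = (3/5 − ζ_m)(ζ_n − ζ_m)` vanishes only for `ζ_n = ζ_m`, and
`n ↦ (εθ)_n = (1−β)ⁿ(εθ)₀` is injective. [cite: Enflo2023, v2 (45)–(46) p.19] -/
theorem fK_invP_eq {C : ℝ} {m n : ℕ}
    (h : InvP C (fK hτ hτ1 hβ0 hβ1 m) (xD - (fK hτ hτ1 hβ0 hβ1 m).v) (fK hτ hτ1 hβ0 hβ1 n)) : n = m := by
  obtain ⟨-, hc, -⟩ := h
  have hv : ∀ k, (fK hτ hτ1 hβ0 hβ1 k).v = zK τ (κseq τ β k) := fun k =>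
    stK_v hτ hτ1 (κseq_pos hτ hτ1 hβ0 hβ1 k) _
  have hpos := fun k => family_pos hτ (by linarith : τ ≤ 1 / 2) (κseq_pos hτ hτ1 hβ0 hβ1 k)
  have h1 : (xD - ((ζK τ (κseq τ β m) : ℝ) : ℂ) • u 1) 1 = xD 1 - ((ζK τ (κseq τ β m) : ℝ) : ℂ) * u 1 1 := rfl
  rw [hv m, hv n, zK, zK, ← sub_smul, inner_smul_right, inner_u_right, h1, xD_one, u_apply_self, mul_one,
    ← Complex.ofReal_sub, ← Complex.ofReal_sub, Complex.conj_ofReal, mul_eq_zero, Complex.ofReal_eq_zero,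
    Complex.ofReal_eq_zero] at hc
  have hζm : ζK τ (κseq τ β m) < 3 / 5 := by
    rw [ζK]; exact div_lt_self (by norm_num) (by linarith [(hpos m).1])
  have hζ : ζK τ (κseq τ β n) = ζK τ (κseq τ β m) := by
    rcases hc with hc | hc
    · linarith
    · exact absurd hc (by linarith)
  have hsnm : sK τ (κseq τ β n) = sK τ (κseq τ β m) := by
    have h2 := hζ
    rw [ζK, ζK, div_eq_div_iff (by linarith [(hpos n).1]) (by linarith [(hpos m).1])] at h2
    linarith
  have he : (fK hτ hτ1 hβ0 hβ1 n).etheta = (fK hτ hτ1 hβ0 hβ1 m).etheta := by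
    rw [fK, fK, stK_etheta, stK_etheta, hζ, hsnm]
  have hE := fK_etheta hτ hτ1 hβ0 hβ1 (σ := τ / 4) (by positivity) (by linarith) le_rfl
  have he0 : 0 < (fK hτ hτ1 hβ0 hβ1 0).etheta := stK_etheta_pos hτ hτ1 (κseq_pos hτ hτ1 hβ0 hβ1 0) _
  rw [hE n, hE m] at he
  exact pow_right_injective₀ (by linarith) (by linarith) (mul_right_cancel₀ he0.ne' he)

/-- **THE RECORD'S `IndepRunD`, RESTRICTED TO THE PIVOT/STATE PAIRS OF THE RUN, HOLDS**: whenever `s_n` lies in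
the epoch invariant of the pivot `s_m` (then `n = m`), (34) holds at `s_n` for the pivot vector `x₀ − v_m` with the
fixed modulus `σ`. (The full `IndepRunD` quantifies over the whole orbit TREE `ReachD`; this file decides it on the
orbit.) [cite: Enflo2023, v2 (34) p.16, (45)–(46) p.19, p.19 L656–L677] -/
theorem fK_indepRun {σ : ℝ} (hσ : 0 < σ) (hστ : σ ≤ τ / 12) (m n : ℕ)
    (h : InvP (22 / σ) (fK hτ hτ1 hβ0 hβ1 m) (xD - (fK hτ hτ1 hβ0 hβ1 m).v) (fK hτ hτ1 hβ0 hβ1 n)) :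
    IndepAtκ (ιS S) σ (fK hτ hτ1 hβ0 hβ1 n) (xD - (fK hτ hτ1 hβ0 hβ1 m).v) := by
  obtain rfl := fK_invP_eq hτ hτ1 hβ0 hβ1 h
  exact fK_indepAtκ hτ hτ1 hβ0 hβ1 hσ hστ _

/-- **A SCHEDULED RUN ALONG WHICH (34) HOLDS AT EVERY STATE WITH ONE FIXED MODULUS.**  For `0 < τ ≤ 1/100`,
`0 < σ ≤ τ/12`, `0 < β ≤ σ²/1000`: an admissible cyclic true-MC start `s₀` and a run `s_n` of the realised Main
Construction over `{S}'` (`ReachD (ιS S) σ β s₀ s_n`) with `(εθ)_n = (1−β)ⁿ(εθ)₀ → 0`, moved parts converging to the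
non-cyclic `(4/5)u₀`, AND: `(εθ)_n > 0`, the two-fold independence (34) `IndepAtκ (ιS S) σ s_n (x₀ − v_n)` at EVERY
`n`, and the record's run-level predicate on every pivot/state pair of the run.  The first positive instance in the
record of the (34)-predicate persisting "to arbitrarily small `(εθ)`'s" (v2 p.19 L656–L661) at a modulus that does
not shrink. [cite: Enflo2023, v2 (34) p.16, (45)–(46) p.19, p.19 L656–L683] -/
theorem exists_scheduled_run_indep {σ : ℝ} (hσ : 0 < σ) (hστ : σ ≤ τ / 12) (hβ : β ≤ σ ^ 2 / 1000) :
    ∃ s₀ : State (TD τ) xD S, 0 < s₀.etheta ∧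
      ((0.09 : ℝ) + (22 / σ + 1) * s₀.etheta ≤ s₀.ε ^ 2 ∧ s₀.ε ^ 2 + (22 / σ + 1) * s₀.etheta ≤ 0.49) ∧
      (∀ i, cf s₀.V i ≠ 0) ∧
      ∃ f : ℕ → State (TD τ) xD S, f 0 = s₀ ∧ (∀ n, ReachD (ιS S) σ β s₀ (f n)) ∧
        (∀ n, (f n).etheta = (1 - β) ^ n * s₀.etheta) ∧
        Tendsto (fun n => xD - (f n).v) atTop (𝓝 (((4 / 5 : ℝ) : ℂ) • u 0)) ∧
        (∀ n, 0 < (f n).etheta) ∧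
        (∀ n, IndepAtκ (ιS S) σ (f n) (xD - (f n).v)) ∧
        (∀ m n, InvP (22 / σ) (f m) (xD - (f m).v) (f n) → IndepAtκ (ιS S) σ (f n) (xD - (f m).v)) := by
  have hσ1 : σ ≤ 1 := by linarith
  have hστ4 : σ ≤ τ / 4 := by linarith
  have hκ0 := κseq_pos hτ hτ1 hβ0 hβ1 0
  have hs0 : sK τ (κseq τ β 0) = β := sK_κseq_zero hτ (by linarith) hβ0.le
  have he : (fK hτ hτ1 hβ0 hβ1 0).etheta = ζK τ (κseq τ β 0) ^ 2 * β := by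
    rw [fK, stK_etheta, hs0]
  have hε : (fK hτ hτ1 hβ0 hβ1 0).ε = ζK τ (κseq τ β 0) := stK_ε hτ hτ1 hκ0 _
  have hζ : ζK τ (κseq τ β 0) * (1 + β) = 3 / 5 := by
    rw [ζK, hs0]; exact div_mul_cancel₀ _ (by positivity)
  refine ⟨fK hτ hτ1 hβ0 hβ1 0, stK_etheta_pos hτ hτ1 hκ0 _, ?_, cf_stK_ne hτ hτ1 hκ0 _, fK hτ hτ1 hβ0 hβ1, rfl,
    fK_reachD hτ hτ1 hβ0 hβ1 hσ hσ1 hστ4, fK_etheta hτ hτ1 hβ0 hβ1 hσ hσ1 hστ4, fK_tendsto hτ hτ1 hβ0 hβ1,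
    fun n => stK_etheta_pos hτ hτ1 (κseq_pos hτ hτ1 hβ0 hβ1 n) _, fK_indepAtκ hτ hτ1 hβ0 hβ1 hσ hστ,
    fK_indepRun hτ hτ1 hβ0 hβ1 hσ hστ⟩
  rw [he, hε]
  exact start_arith hσ hσ1 hβ0 hβ (hζ) (family_pos hτ (by linarith) hκ0).2.1

omit hβ1 in
/-- **AT THE TEXT'S MODULUS `σ = δ₂ = (τ/2)²`** (the model's own type-1 constant, `Diag.type1`; `δ₂ ≤ τ/12` since
`τ ≤ 1/100`): a scheduled run to arbitrarily small `(εθ)`'s along which (34) holds at every state with modulus `δ₂`.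
[cite: Enflo2023, v2 p.6 (type 1), (34) p.16, p.19 L656–L677] -/
theorem exists_scheduled_run_indep_at_type1Const (hβ : β ≤ ((τ / 2) ^ 2) ^ 2 / 1000) :
    ∃ s₀ : State (TD τ) xD S, 0 < s₀.etheta ∧ (∀ i, cf s₀.V i ≠ 0) ∧
      ∃ f : ℕ → State (TD τ) xD S, f 0 = s₀ ∧ (∀ n, ReachD (ιS S) ((τ / 2) ^ 2) β s₀ (f n)) ∧
        (∀ n, (f n).etheta = (1 - β) ^ n * s₀.etheta) ∧
        Tendsto (fun n => xD - (f n).v) atTop (𝓝 (((4 / 5 : ℝ) : ℂ) • u 0)) ∧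
        (∀ n, 0 < (f n).etheta) ∧
        (∀ n, IndepAtκ (ιS S) ((τ / 2) ^ 2) (f n) (xD - (f n).v)) := by
  have h4 : ((τ / 2) ^ 2) ^ 2 ≤ 1 := pow_le_one₀ (sq_nonneg _) (by nlinarith)
  have hβ1 : β ≤ 1 / 1000 := hβ.trans (div_le_div_of_nonneg_right h4 (by norm_num))
  obtain ⟨s₀, he, -, hc, f, h0, hr, hfe, ht, hp, hi, -⟩ :=
    exists_scheduled_run_indep hτ hτ1 hβ0 hβ1 (σ := (τ / 2) ^ 2) (by positivity) (by nlinarith) hβ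
  exact ⟨s₀, he, hc, f, h0, hr, hfe, ht, hp, hi⟩

end orbit

end Diag

end StepRealisation

end Literature.Analysis.OperatorTheory.Enflo2023
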